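import Literature.MathematicalPhysics.QuantumFieldTheory.Balaban1983to89.B2Prop22Proof
import Literature.MathematicalPhysics.QuantumFieldTheory.Balaban1983to89.B4ThmTorusPairEta
import Literature.MathematicalPhysics.QuantumFieldTheory.Balaban1983to89.B4Eq12ExpFlow

/-!
# `Balaban1983to89.B2Prop22RegularRegionPair` — [Balaban1982Higgs2] **Proposition 2.2** (2.58) pp. 570–571 AT EVERY
# (I.2.23)/(1.7)-REGULAR VECTOR FIELD `A ≠ 0` ON THE FAMILY OF GENERAL PAIRS `Ω ⊂ Ω₀` OF FINITE UNIONS OF BIG BLOCKS OF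
# `ηℤ^{d+1}` — r14's decl of record `B2StepK.Prop22Printed` INHABITED by «a simple corollary of Proposition I.2.1»: p17's
# bridge `B2Prop22Proof.prop22Printed_of_B4clause` fed with r01's PROVED Theorem p. 573 of [Balaban1983RegularityDecay]
# (`B4ThmRegionPairEta.thmPrintedNN_regionPairFam`, row B4.Thm@573 = Prop. I.2.1) and the dictionary facts for THAT
# CARRIER's genuine adjoint averaging operator `Q_k^*(A)`

statement-level skeleton of published theorems with citation tags; proofs where landed; nothing here is a claim about the Yang–Mills mass gap

PDF held: `paper:balaban1982-cmp86-higgs23-ii` (journal page = PDF page + 554); II pp. 570–571 re-read on the ×2 render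
`run/shared/lean/pub/pub-balaban/b2b-balaban-ref1/pages/1982-cmp86-higgs23-II/1982-cmp86-higgs23-II-p017-x2.png` and the text
layer `p0016.txt` L31–34 / `p0017.txt` L1–5 (this session); companion `paper:balaban1983-cmp89-regularity-decay` (B4, p. 573).

CITATION HEADER (lean-in-tree rule).  T. Bałaban, *(Higgs)₂,₃ quantum fields in a finite volume. II. An upper bound*,
Commun. Math. Phys. **86** (1982) 555–594 [Balaban1982Higgs2], Prop. 2.2 (2.58) pp. 570–571; T. Bałaban, *Regularity and
decay of lattice Green's functions*, Commun. Math. Phys. **89** (1983) 571–597 [Balaban1983RegularityDecay], Theorem p. 573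
(= Prop. I.2.1 of [Balaban1982Higgs1] p. 610).  Cell `lit-balaban` (HOME `run/shared/lean/pub/lit-balaban/`), Phase-2 proof
seat **p23** gen 14 (unit `lit-balaban-p23-g14`); SKELETON row **B2.Prop2.2** (fold owner r02, twin r14; decl of record
`B2StepK.Prop22Printed`, r14 p239461 — UNCHANGED), xref rows B1.Prop2.1 / B4.Thm@573; kind «knitting at a regular field
A ≠ 0»; no head claim (cells are the owner's).  USED BY NAME, NOTHING RESTATED: p17 g2 `B2Prop22Proof.{Dict, Dict.toP22,
prop22Printed_of_B4clause}` (p248248); r01 g8 `B4ThmRegionPairEta.{RegionPairInst, regionPairFam, Kmod,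
thmPrintedNN_regionPairFam, hypotheses_met, RegionPairInst.(GΩ, G₀, DΩ, D₀, deltaV, extR, resR, supp, sdist1, cdist,
bdistS, cdist_mul_le, extR_incl, extR_of_not_inReg, DΩ_resR_apply)}` (p314051); r01 g9 `B4ThmTorusPairEta.{lat_mem_supp,
lat_le_sdist1, lat_le_bdistS}` (p318600); r01 `B4RegionCubeCarrier.{incl, inclY, inReg, inReg_iff, contourTrans_incl}`,
`B4Eq221L2FactorRegion.acBond`, `B4Lower18RegularRegion.{rBlkWt, rbaseEmb, rstairContour, rbaseEmb_blk}`,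
`B4Lower18Regular.base_le_of_blk`, `B4Eq12ExpFlow.{expFlow, expFlow_lipschitz}`; b04 `B4GaugeCovariance.{avgOp, contourTrans,
fieldLink, b4Op, covLap, fld, OrthFlow}`; pv-lineage `B4Lemma22PertVSup.{contourTrans_fieldLink, fld_avgOp_transpose_mulVec}`,
`B4Lemma22ReduceDeriv.siteNorm_flow`, `B4Lemma22Reduce231.{supN, siteNorm, …}`, `B4Thm112BoxValue.{abs_apply_le_siteNorm',
siteNorm_le_sqrt_card_mul}`.

WHAT IS PRINTED (verbatim, II pp. 570–571 [PDF 16–17]): *"**Proposition 2.2.** Let Ω and A satisfy the assumptions of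
Proposition I.2.1, then for e(L^kε) sufficiently small there exist positive constants δ₀, c₀, R₀ independent of A, k, Ω and
depending on d, a, M, such that |(D^η_AG_k(Ω, A)Q_k^*(A))(b, y)| ≦ c₀ exp(−δ₀ dist(b, y)),  (2.58)  for b ⊂ Ω,
dist(b, Ωᶜ) ≧ R₀, y ∈ Ω^{(k)}. The identical inequality holds for G_k(Ω, A)Q_k^*(A), and for D^η_AδG_k(Ω,Ω₀, A)Q_k^*(A),
δG_k(Ω,Ω₀, A)Q_k^*(A) with the additional factor exp(−δ₀(dist(b,Ωᶜ) + dist(y,Ωᶜ))).  This proposition is a simple corollary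
of Proposition I.2.1."*  Proposition I.2.1 ([Balaban1982Higgs1] p. 610) = [Balaban1983RegularityDecay] Theorem p. 573
(row B4.Thm@573, head `proved p314051`): for `A` regular on `Ω`, a union of big blocks, (1.10) `|(D^η_{A,μ}G_k(Ω,A)f)(x)|,
|(G_k(Ω,A)f)(x)| ≦ c₀ exp(−δ₀ dist(x, supp f))‖f‖_∞` for `dist(x, Ωᶜ) ≧ R₀`, and (1.11)–(1.12) the same for `δG_k(Ω,Ω₀,A)`
with the additional factor.  THE DICTIONARY behind «simple corollary» (p17's `B2Prop22Proof`): the column `y` of the kernel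
of `TQ_k^*(A)` is `T` applied to the source `f_{y,v} = Q_k^*(A)(vδ_y)`, supported in `B^k(y)`, `‖f_{y,v}‖_∞ = |v|`.

WHAT THIS MODULE PROVES (kernel-checked, 0 `sorry`, no new `def … : Prop`; axioms standard).
* §1 THE SOURCE ON r01's REGION CARRIERS, generic in the bond function: `avgQ` = the averaging operator `Q_k(A)` of the
  carrier (block weights `1[x ∈ B^k(y)]`, staircase contours, link variables `U(eηA_b)`) with **`b4Op_eq_avgQ`** (the
  carrier's operator (1.6) IS `−Δ_A + m² + a·(avgQ)ᵀ(avgQ)`, definitional — so this `Q_k^*(A)` is the one inside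
  `G_k(Ω,A)`); `single` (`vδ_y`), **`srcQ`** (`f_{y,v} = (avgQ)ᵀ(vδ_y)`), `fld_srcQ` (`f_{y,v}(x) = 1[x ∈ B^k(y)]U(A(Γ_{y,x}))ᵀv`),
  **`siteNorm_fld_srcQ`** (`|f_{y,v}(x)| = 1[x ∈ B^k(y)]·|v|`, orthogonality of the transporters), `supN_srcQ_le`
  (`‖f_{y,v}‖_∞ ≤ |v|`), `srcQ_apply_eq_zero_of_blk_ne` / `exists_srcQ_apply_ne_zero` (`supp f_{y,v} = B^k(y)` for `v ≠ 0`),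
  `fld_mul_avgQ_transpose_mulVec_single` (the `(x,y)` block of `TQ_k^*` applied to `v` is `(Tf_{y,v})(x)`), `srcQ_smul`,
  `supNorm_sub_base_le` (block geometry), `siteNorm_fld_mulVec_single_le` (every kernel block is a bounded operator).
* §2 `Sphere` (unit sphere of `ℝ^N`, the test vectors), `homog_bound_of_sphere` / `bddAbove_sphere_of_homog`;
  **`cdist_le_cdist_add`** (`dist(·, Ωᶜ)` is 1-Lipschitz); for r01's instances: `blk_eq_of_mem_supp_srcQ`,
  `base_mem_supp_srcQ`, **`dxy_le_sdist1_srcQ`** (`dist(x, L^ky) ≤ dist(x, supp f_{y,v}) + 1`), **`ydist_le_bdistS_srcQ`**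
  (`dist(L^ky, Ωᶜ) ≤ dist(supp f_{y,v}, Ωᶜ) + 1`).
* §3 for a member `i` of `regionPairFam`: `lsrc` / `lsrc₀` (the source on `Ω` / on `Ω₀`), `lbase`, `ldist`
  (`dist(x,y) = |x − L^ky|_∞` in unit-lattice units), **`extR_lsrc`** (`E(Q_k^{*,Ω}(A)(vδ_y)) = Q_k^{*,Ω₀}(A)(vδ_y)`),
  `deltaV_smul`, the four homogeneous bounds `valG_lsrc_le` / `valDG_lsrc_le` / `dvalG_lsrc_le` / `dvalDG_lsrc_le` (the sphere
  suprema defining the kernels are suprema of BOUNDED families — no `Real.iSup` junk), and **`latDict`**: p17's `Dict 1` at the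
  member with every dictionary hypothesis DISCHARGED (`supNorm_src`, `dxy_le`, `ydist_le`, `dby_le`, `bdistB_le`); `kGQ_latDict`.
* §4 **`prop22Printed_regionPairFam`**: `B2StepK.Prop22Printed (fun i => (latDict U c β Kmod i).toP22)` — PROP. 2.2 AT EVERY
  (1.7)-REGULAR FIELD on r01's family (every scale `k ≥ 1`, EVERY pair `Ω ⊂ Ω₀` of finite unions of `Kmod`-blocks of
  `ηℤ^{d+1}`, every field regular on `Ω₀`, `0 < e ≤ e₁`), constants `δ₀, c₀e^{2δ₀}, R₀, e₁` of r01's α = 0 clause;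
  `prop22Printed_regionPairFam_exp` (the printed link variables `e^{qeηA}`, every antisymmetric `q`);
  `regionPairFam_nonvacuous`; **`ineq258_regionPairFam`** — (2.58) EXPLICITLY, all four clauses, for every `v ∈ ℝ^N`:
  `|(G_kQ_k^*)(x,y)v| ≤ c₀e^{−δ₀dist(x,y)}|v|` at `dist(x,Ωᶜ) ≥ R₀`, the `D^η_{A,μ}` version on every bond `⟨x,x+ηe_μ⟩ ⊂ Ω`,
  and the two `δG_k` versions with the factor `exp(−δ₀(dist(x,Ωᶜ) + dist(L^ky,Ωᶜ)))`.
HONEST SCOPE.  (i) KNITTING: the analysis is r01's ([Balaban1983RegularityDecay] Theorem at a regular field by the §2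
random-walk expansion, B4 sub-cell) and the bridge is p17's; no new estimate is proved here.  (ii) The carriers are r01's
readings: abelian one-parameter orthogonal flow (1.2) (the print's generality; `N = |ι| ≥ 1`), component fields `A_ν(x)` on
the fine lattice `ηℤ^{d+1}`, the averaging contours `Γ^{(k)}_{y,x}` read as the staircase from the base corner of `B^k(y)`,
distances in the `ℓ^∞` metric in unit-lattice (`T_η`) units, `Kmod`, `δ₀ = (4Kmod)⁻¹`, `R₀ = Kmod(d+4)+2`, `e₁`, `c₀` functions
of `(d, L, a₋, a₊, m²₊, c, β, ℓ₁)` only — «independent of A, k, Ω».  [Balaban1982Higgs2] works on the TORUS `T_η`: the torus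
region pairs `Ω ⊂ Ω₀ ⊂ T_η` are the sibling file `B2Prop22RegularTorusPair` (same seat); the (Higgs)₂,₃ carrier
`HiggsCovariance.avgQkAdj` (composite contours I (2.11)) is not a member of r01's families (p35 g11's note in
`B1Prop21RegularFieldFams`).  (iii) READINGS, each in the faithful direction: `|·|` of the `N × N` kernel block = its operator
norm (`sup_{|v|=1}`); `y ∈ Ω^{(k)}` as the point `L^ky` of the fine lattice (I p. 605 «T_1^{(k)} ⊂ T_η») in `dist(b,y)`,
`dist(y,Ωᶜ)`; the bond `b` read at `b₋` in `dist(b,y)`, `dist(b,Ωᶜ)` (`dist(b,·) ≤ dist(b₋,·)`, so the restriction is weaker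
and the bounds stronger than printed); the `δG_k` source on `Ω₀` is the SAME `Q_k^*(A)(vδ_y)` (`extR_lsrc`).  (iv) The printed
restriction `dist(·, Ωᶜ) ≥ R₀` is LIVE (r01's `rect := False`); no «rectangular parallelepiped» waiver is claimed.  (v) No row
head changes (owner r02).  Nothing here is summit progress.
-/

namespace Literature.MathematicalPhysics.QuantumFieldTheory.Balaban1983to89.B2Prop22RegularRegionPair

open Literature.MathematicalPhysics.QuantumFieldTheory.Balaban1983to89
open Literature.MathematicalPhysics.QuantumFieldTheory.Balaban1983to89.B4GaugeCovariance
open Literature.MathematicalPhysics.QuantumFieldTheory.Balaban1983to89.B4Reflection242 (blk blk_mul supNorm_add_le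
  supNorm_le_of_forall)
open Literature.MathematicalPhysics.QuantumFieldTheory.Balaban1983to89.B4ContourShift (supNorm supNorm_nonneg
  exists_supNorm_eq abs_le_supNorm)
open Literature.MathematicalPhysics.QuantumFieldTheory.Balaban1983to89.B4Lower18 (fineDom mem_fineDom)
open Literature.MathematicalPhysics.QuantumFieldTheory.Balaban1983to89.B4Lower18Regular (e1 base_le_of_blk)
open Literature.MathematicalPhysics.QuantumFieldTheory.Balaban1983to89.B4Lower18RegularRegion (regWt rBlkWt rbaseEmb
  rstairContour compField rBlkWt_nonneg rbaseEmb_blk)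
open Literature.MathematicalPhysics.QuantumFieldTheory.Balaban1983to89.B4Lemma21Region (siteNorm regionOp regionDeriv)
open Literature.MathematicalPhysics.QuantumFieldTheory.Balaban1983to89.B4Lemma22Reduce231 (supN le_supN supN_le
  supN_nonneg siteNorm_nonneg siteNorm_smul siteNorm_zero siteNorm_sq siteNorm_normalize)
open Literature.MathematicalPhysics.QuantumFieldTheory.Balaban1983to89.B4Lemma22ReduceDeriv (siteNorm_flow)
open Literature.MathematicalPhysics.QuantumFieldTheory.Balaban1983to89.B4Lemma22PertVSup (contourTrans_fieldLink
  fld_avgOp_transpose_mulVec)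
open Literature.MathematicalPhysics.QuantumFieldTheory.Balaban1983to89.B4Eq221L2FactorRegion (acBond)
open Literature.MathematicalPhysics.QuantumFieldTheory.Balaban1983to89.B4ThmRegionPairEta (RegionPairInst regionPairFam
  Kmod thmPrintedNN_regionPairFam hypotheses_met)
open Literature.MathematicalPhysics.QuantumFieldTheory.Balaban1983to89.B4ThmTorusPairEta (lat_mem_supp lat_le_sdist1
  lat_le_bdistS)
open Literature.MathematicalPhysics.QuantumFieldTheory.Balaban1983to89.B4Eq12ExpFlow (expFlow expFlow_lipschitz)
open Literature.MathematicalPhysics.QuantumFieldTheory.Balaban1983to89.B2Prop22Proof (Dict bound_plain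
  prop22Printed_of_B4clause)
open scoped Matrix

noncomputable section

variable {d : ℕ} {ι : Type} [Fintype ι] [DecidableEq ι]

/-! ## §1. The adjoint averaging source `f_{y,v} = Q_k^*(A)(vδ_y)` on a lattice region (generic bond function) -/

section Source

variable (F : OrthFlow ι) (κ : ℝ) {n : ℕ} (hn : 1 ≤ n) (Ωc : Finset (Fin (d + 1) → ℤ))
  (B : ↥(fineDom n Ωc) → ↥(fineDom n Ωc) → ℝ)

/-- **THE AVERAGING OPERATOR `Q_k(A)` OF THE REGION CARRIERS** (I (2.11) p. 609 / [B4] (1.4) p. 572): block weights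
`1[x ∈ B^k(y)]`, transporters `U(A(Γ^{(k)}_{y,x}))` along the staircase contours from the base corner of `B^k(y)`, for the
link variables `U(κA_b)` of the bond function `B` — verbatim the `Q` inside r01's `regionOp` / `torusOp`
(`= −Δ_A + m² + a_kQ_k(A)^*Q_k(A)`, `regionOp_eq_avgQ` below). [cite: Balaban1982Higgs2, p.570 «Q_k^*(A)»; Balaban1983RegularityDecay, (1.4) p.572] -/
def avgQ : Matrix (↥Ωc × ι) (↥(fineDom n Ωc) × ι) ℝ :=
  avgOp (rBlkWt n Ωc (fineDom n Ωc)) (contourTrans (fieldLink F κ B) (rbaseEmb hn Ωc) (rstairContour hn Ωc))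

/-- **`P_k(A) = Q_k(A)^*Q_k(A)` INSIDE THE CARRIER'S OPERATOR (1.6)**: b04's `b4Op` at the region data is
`−Δ_{A} + m² + a·(avgQ)ᵀ(avgQ)` — so the `Q_k^*(A)` of this file IS the adjoint of the averaging operator whose `P_k(A)`
enters `G_k(Ω,A) = (−Δ^{η,N}_{A,Ω} + m² + a_kP_k(A))⁻¹` (definitional). [cite: Balaban1983RegularityDecay, (1.5)–(1.6) p.572] -/
theorem b4Op_eq_avgQ (c : ↥(fineDom n Ωc) → ↥(fineDom n Ωc) → ℝ) (m2 a : ℝ) :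
    b4Op F κ c m2 a (rBlkWt n Ωc (fineDom n Ωc)) (rbaseEmb hn Ωc) (rstairContour hn Ωc) B
      = covLap c (fieldLink F κ B) + m2 • (1 : Matrix _ _ ℝ) + a • ((avgQ F κ hn Ωc B)ᵀ * avgQ F κ hn Ωc B) := rfl

/-- the coarse-lattice source `vδ_y` (`v ∈ ℝ^N` at the label `y`, `0` elsewhere). [cite: Balaban1982Higgs2, p.570, dictionary] -/
def single {Y : Type} [DecidableEq Y] (y : Y) (v : ι → ℝ) : Y × ι → ℝ := fun p => if p.1 = y then v p.2 else 0

omit [Fintype ι] [DecidableEq ι] in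
/-- site values of `vδ_y`. [cite: Balaban1982Higgs2, Prop. 2.2 (2.58) p.570, dictionary] -/
theorem fld_single {Y : Type} [DecidableEq Y] (y y' : Y) (v : ι → ℝ) : fld (single y v) y' = if y' = y then v else 0 := by
  funext j
  by_cases h : y' = y <;> simp [single, fld, h]

omit [Fintype ι] [DecidableEq ι] in
/-- `vδ_y` is homogeneous in `v`. [cite: Balaban1982Higgs2, Prop. 2.2 (2.58) p.570, dictionary] -/
theorem single_smul {Y : Type} [DecidableEq Y] (y : Y) (c : ℝ) (v : ι → ℝ) : single y (c • v) = c • single y v := by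
  funext p
  by_cases h : p.1 = y <;> simp [single, h]

omit [Fintype ι] [DecidableEq ι] in
/-- the entries of `vδ_y` are bounded by `|v|`. [cite: Balaban1982Higgs2, Prop. 2.2 (2.58) p.570, dictionary] -/
theorem abs_single_le {Y : Type} [DecidableEq Y] [Fintype ι] (y : Y) (v : ι → ℝ) (p : Y × ι) :
    |single y v p| ≤ siteNorm v := by
  unfold single
  split_ifs
  · exact B4Thm112BoxValue.abs_apply_le_siteNorm' v p.2
  · rw [abs_zero]; exact siteNorm_nonneg v

omit [DecidableEq ι] in
/-- **A GENERIC KERNEL-COLUMN BOUND**: `|(M(vδ_y))(x)| ≤ √N·Σ_{j,q}|M_{(x,j),q}|·|v|` — every block of a finite matrix is a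
bounded operator on `ℝ^N` (used only to certify that the suprema over the unit sphere defining the kernels of (2.58) are
suprema of BOUNDED families). [cite: Balaban1982Higgs2, Prop. 2.2 (2.58) p.570, dictionary] -/
theorem siteNorm_fld_mulVec_single_le {X Y : Type} [Fintype Y] [DecidableEq Y] (M : Matrix (X × ι) (Y × ι) ℝ) (x : X)
    (y : Y) (v : ι → ℝ) :
    siteNorm (fld (M *ᵥ single y v) x) ≤ Real.sqrt (Fintype.card ι) * ((∑ j, ∑ q, |M (x, j) q|) * siteNorm v) := by
  refine B4Thm112BoxValue.siteNorm_le_sqrt_card_mul _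
    (mul_nonneg (Finset.sum_nonneg fun _ _ => Finset.sum_nonneg fun _ _ => abs_nonneg _) (siteNorm_nonneg v)) fun j => ?_
  calc |fld (M *ᵥ single y v) x j| = |∑ q, M (x, j) q * single y v q| := rfl
    _ ≤ ∑ q, |M (x, j) q * single y v q| := Finset.abs_sum_le_sum_abs _ _
    _ ≤ ∑ q, |M (x, j) q| * siteNorm v := Finset.sum_le_sum fun q _ => by
        rw [abs_mul]; exact mul_le_mul_of_nonneg_left (abs_single_le y v q) (abs_nonneg _)
    _ = (∑ q, |M (x, j) q|) * siteNorm v := (Finset.sum_mul _ _ _).symm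
    _ ≤ (∑ j, ∑ q, |M (x, j) q|) * siteNorm v :=
        mul_le_mul_of_nonneg_right (Finset.single_le_sum (f := fun j => ∑ q, |M (x, j) q|)
          (fun j _ => Finset.sum_nonneg fun q _ => abs_nonneg _) (Finset.mem_univ j)) (siteNorm_nonneg v)

/-- **THE SOURCE `f_{y,v} = Q_k^*(A)(vδ_y)`** — the column `y` of the kernel of `T·Q_k^*(A)` is `T f_{y,·}` (II p. 570,
I (2.11)/(2.20): `(Q_k^*(A)ψ)(x) = U(A(Γ^{(k)}_{y,x}))^*ψ(y)` for `x ∈ B^k(y)`, weight `1`). [cite: Balaban1982Higgs2, Prop. 2.2 p.570, dictionary] -/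
def srcQ (y : ↥Ωc) (v : ι → ℝ) : ↥(fineDom n Ωc) × ι → ℝ := (avgQ F κ hn Ωc B)ᵀ *ᵥ single y v

/-- `f_{y,v}(x) = 1[x ∈ B^k(y)]·U(A(Γ^{(k)}_{y,x}))ᵀv`. [cite: Balaban1982Higgs2, p.570 «Q_k^*(A)»; Balaban1983RegularityDecay, (1.4) p.572] -/
theorem fld_srcQ (y : ↥Ωc) (v : ι → ℝ) (x : ↥(fineDom n Ωc)) :
    fld (srcQ F κ hn Ωc B y v) x
      = rBlkWt n Ωc (fineDom n Ωc) y x •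
          ((contourTrans (fieldLink F κ B) (rbaseEmb hn Ωc) (rstairContour hn Ωc) y x)ᵀ *ᵥ v) := by
  rw [srcQ, avgQ, fld_avgOp_transpose_mulVec, Finset.sum_eq_single y]
  · rw [fld_single, if_pos rfl]
  · intro y' _ hy'
    rw [fld_single, if_neg hy', Matrix.mulVec_zero, smul_zero]
  · intro h; exact absurd (Finset.mem_univ y) h

/-- **`|f_{y,v}(x)| = 1[x ∈ B^k(y)]·|v|`** — the transporters are orthogonal (I p. 605: `U` takes values in `O(N)`).
[cite: Balaban1982Higgs2, p.570; Balaban1982Higgs1, p.605 «‖f‖_∞»] -/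
theorem siteNorm_fld_srcQ (y : ↥Ωc) (v : ι → ℝ) (x : ↥(fineDom n Ωc)) :
    siteNorm (fld (srcQ F κ hn Ωc B y v) x) = (if blk n x.1 = y.1 then 1 else 0) * siteNorm v := by
  rw [fld_srcQ, siteNorm_smul, contourTrans_fieldLink, F.transpose_eq, siteNorm_flow]
  unfold rBlkWt
  split_ifs <;> simp

/-- **`‖f_{y,v}‖_∞ ≤ |v|`**. [cite: Balaban1982Higgs2, Prop. 2.2 p.571 «simple corollary»; Balaban1982Higgs1, (2.25) p.610 «‖f‖_∞»] -/
theorem supN_srcQ_le (y : ↥Ωc) (v : ι → ℝ) : supN (srcQ F κ hn Ωc B y v) ≤ siteNorm v := by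
  refine supN_le (siteNorm_nonneg v) fun x => ?_
  rw [siteNorm_fld_srcQ]
  split_ifs
  · rw [one_mul]
  · rw [zero_mul]; exact siteNorm_nonneg v

omit [DecidableEq ι] in
/-- a site value with zero norm vanishes. [cite: Balaban1982Higgs2, Prop. 2.2 (2.58) p.570, dictionary] -/
theorem eq_zero_of_siteNorm_eq_zero {w : ι → ℝ} (h : siteNorm w = 0) : w = 0 := by
  have h2 : w ⬝ᵥ w = 0 := by rw [← siteNorm_sq, h]; ring
  exact dotProduct_self_eq_zero.mp h2

/-- **`supp f_{y,v} ⊆ B^k(y)`**: `f_{y,v}` vanishes off the block of `y`. [cite: Balaban1982Higgs2, p.570 «Q_k^*(A)», dictionary] -/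
theorem srcQ_apply_eq_zero_of_blk_ne (y : ↥Ωc) (v : ι → ℝ) {x : ↥(fineDom n Ωc)} (hx : blk n x.1 ≠ y.1) (j : ι) :
    srcQ F κ hn Ωc B y v (x, j) = 0 := by
  have h := siteNorm_fld_srcQ F κ hn Ωc B y v x
  rw [if_neg hx, zero_mul] at h
  exact congrFun (eq_zero_of_siteNorm_eq_zero h) j

/-- **`B^k(y) ⊆ supp f_{y,v}` for `v ≠ 0`**: at every point of the block some component of `f_{y,v}` is non-zero.
[cite: Balaban1982Higgs2, p.570 «Q_k^*(A)», dictionary] -/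
theorem exists_srcQ_apply_ne_zero (y : ↥Ωc) {v : ι → ℝ} (hv : siteNorm v ≠ 0) {x : ↥(fineDom n Ωc)}
    (hx : blk n x.1 = y.1) : ∃ j, srcQ F κ hn Ωc B y v (x, j) ≠ 0 := by
  by_contra h
  have h0 : fld (srcQ F κ hn Ωc B y v) x = 0 := funext fun j => not_not.mp ((not_exists.mp h) j)
  have h1 := siteNorm_fld_srcQ F κ hn Ωc B y v x
  rw [h0, siteNorm_zero, if_pos hx, one_mul] at h1
  exact hv h1.symm

/-- **THE KERNEL READING**: the `(x, y)` block of `T·Q_k^*(A)` applied to `v` is `(T f_{y,v})(x)`. [cite: Balaban1982Higgs2, (2.58) p.570, dictionary] -/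
theorem fld_mul_avgQ_transpose_mulVec_single (T : Matrix (↥(fineDom n Ωc) × ι) (↥(fineDom n Ωc) × ι) ℝ) (y : ↥Ωc)
    (v : ι → ℝ) (x : ↥(fineDom n Ωc)) :
    fld ((T * (avgQ F κ hn Ωc B)ᵀ) *ᵥ single y v) x = fld (T *ᵥ srcQ F κ hn Ωc B y v) x := by
  rw [srcQ, Matrix.mulVec_mulVec]

/-- `f_{y,v}` is homogeneous in `v`. [cite: Balaban1982Higgs2, Prop. 2.2 (2.58) p.570, dictionary] -/
theorem srcQ_smul (y : ↥Ωc) (c : ℝ) (v : ι → ℝ) : srcQ F κ hn Ωc B y (c • v) = c • srcQ F κ hn Ωc B y v := by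
  unfold srcQ; rw [single_smul, Matrix.mulVec_smul]

omit [Fintype ι] [DecidableEq ι] in
/-- **the block geometry**: a fine point of `B^k(y)` is within `n` fine units (`= 1` unit-lattice unit) of the base corner
`n·y` in the sup-norm. [cite: Balaban1982Higgs1, (1.17) p.607 «B(y) = {x : y_μ ≦ x_μ < y_μ + L}», dictionary] -/
theorem supNorm_sub_base_le {n : ℕ} (hn : 1 ≤ n) {z y : Fin (d + 1) → ℤ} (h : blk n z = y) :
    supNorm (z - fun i => (n : ℤ) * y i) ≤ (n : ℝ) := by
  obtain ⟨hlow, hup⟩ := base_le_of_blk hn h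
  refine supNorm_le_of_forall fun i => ?_
  have h1 : (n : ℤ) * y i ≤ z i := hlow i
  have h2 : z i - n * y i ≤ n := hup i
  have : |z i - (n : ℤ) * y i| ≤ n := abs_le.mpr ⟨by linarith, h2⟩
  exact_mod_cast this

end Source

/-! ## §2. Test vectors and the Lipschitz property of `dist(·, Ω^c)` -/

/-- the unit sphere of `ℝ^N` — the test vectors `v` over which `|(TQ_k^*(A))(x,y)| = sup_{|v|=1} |(Tf_{y,v})(x)|` (the
operator norm of the `N × N` block). [cite: Balaban1982Higgs2, (2.58) p.570, dictionary] -/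
def Sphere (ι : Type) [Fintype ι] : Type := {v : ι → ℝ // siteNorm v = 1}

omit [DecidableEq ι] in
/-- the unit sphere of `ℝ^N` is non-empty for `N ≥ 1`. [cite: Balaban1982Higgs2, Prop. 2.2 (2.58) p.570, dictionary] -/
theorem sphere_nonempty [Nonempty ι] : Nonempty (Sphere ι) := by
  let w : ι → ℝ := fun _ => 1
  have hw : siteNorm w ≠ 0 := fun h =>
    one_ne_zero (congrFun (eq_zero_of_siteNorm_eq_zero h) (Classical.arbitrary ι))
  exact ⟨⟨(siteNorm w)⁻¹ • w, siteNorm_normalize hw⟩⟩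

section Lattice

variable {ℓ : ℕ} {amin aplus m2plus : ℝ} (i : RegionPairInst d ℓ amin aplus m2plus)

omit [Fintype ι] [DecidableEq ι] in
/-- **`dist(·, Ω^c)` IS 1-LIPSCHITZ** (unit-lattice units): `dist(u, Ω^c) ≤ dist(z, Ω^c) + |u − z|_∞/n`.
[cite: Balaban1983RegularityDecay, Theorem p.573 «dist(x, Ω^c)», dictionary] -/
theorem cdist_le_cdist_add (u z : ↥(fineDom ((ℓ + 1) ^ i.k) i.Ωc)) :
    i.cdist u ≤ i.cdist z + supNorm (u.1 - z.1) / (((ℓ + 1) ^ i.k : ℕ) : ℝ) := by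
  have hnr : (0 : ℝ) < (((ℓ + 1) ^ i.k : ℕ) : ℝ) := by exact_mod_cast Nat.one_le_pow i.k (ℓ + 1) (Nat.succ_pos ℓ)
  rcases isEmpty_or_nonempty {w : Fin (d + 1) → ℤ // w ∉ fineDom ((ℓ + 1) ^ i.k) i.Ωc} with hE | hE
  · have h0 : i.cdist u = 0 := by unfold RegionPairInst.cdist; exact Real.iInf_of_isEmpty _
    rw [h0]
    exact add_nonneg (i.cdist_nonneg z) (div_nonneg (supNorm_nonneg _) hnr.le)
  · have key : ∀ w : {w : Fin (d + 1) → ℤ // w ∉ fineDom ((ℓ + 1) ^ i.k) i.Ωc},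
        i.cdist u - supNorm (u.1 - z.1) / (((ℓ + 1) ^ i.k : ℕ) : ℝ)
          ≤ supNorm (z.1 - w.1) / (((ℓ + 1) ^ i.k : ℕ) : ℝ) := by
      intro w
      have h1 := i.cdist_mul_le u w.2
      have h2 : supNorm (u.1 - w.1) ≤ supNorm (u.1 - z.1) + supNorm (z.1 - w.1) := by
        rw [← sub_add_sub_cancel u.1 z.1 w.1]; exact supNorm_add_le _ _
      rw [sub_le_iff_le_add, ← add_div, le_div_iff₀ hnr]
      linarith
    have h3 : i.cdist u - supNorm (u.1 - z.1) / (((ℓ + 1) ^ i.k : ℕ) : ℝ) ≤ i.cdist z := le_ciInf key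
    linarith

/-- **the support of `f_{y,v}` lies in `B^k(y)`** (labels). [cite: Balaban1982Higgs2, p.570 «Q_k^*(A)», dictionary] -/
theorem blk_eq_of_mem_supp_srcQ (F : OrthFlow ι) (κ : ℝ) (B : ↥(fineDom ((ℓ + 1) ^ i.k) i.Ωc) → ↥(fineDom ((ℓ + 1) ^ i.k) i.Ωc) → ℝ)
    (y : ↥i.Ωc) (v : ι → ℝ) {z : ↥(fineDom ((ℓ + 1) ^ i.k) i.Ωc)}
    (hz : z ∈ i.supp (srcQ F κ (Nat.one_le_pow i.k (ℓ + 1) (Nat.succ_pos ℓ)) i.Ωc B y v)) :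
    blk ((ℓ + 1) ^ i.k) z.1 = y.1 := by
  obtain ⟨j, hj⟩ := (lat_mem_supp i).1 hz
  by_contra h
  exact hj (srcQ_apply_eq_zero_of_blk_ne F κ _ i.Ωc B y v h j)

/-- **the base corner `n·y` of `B^k(y)` lies in the support of `f_{y,v}`** (`|v| = 1`). [cite: Balaban1982Higgs2, p.570 «Q_k^*(A)», dictionary] -/
theorem base_mem_supp_srcQ (F : OrthFlow ι) (κ : ℝ) (B : ↥(fineDom ((ℓ + 1) ^ i.k) i.Ωc) → ↥(fineDom ((ℓ + 1) ^ i.k) i.Ωc) → ℝ)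
    (y : ↥i.Ωc) (v : Sphere ι) :
    rbaseEmb (Nat.one_le_pow i.k (ℓ + 1) (Nat.succ_pos ℓ)) i.Ωc y
      ∈ i.supp (srcQ F κ (Nat.one_le_pow i.k (ℓ + 1) (Nat.succ_pos ℓ)) i.Ωc B y v.1) :=
  (lat_mem_supp i).2 (exists_srcQ_apply_ne_zero F κ _ i.Ωc B y (by rw [v.2]; exact one_ne_zero) (rbaseEmb_blk _ i.Ωc y))

/-- **`dist(x, y) ≤ dist(x, supp f_{y,v}) + 1`** for the corner distance `dist(x, y) = |x − L^ky|_∞` (the point `y` of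
`T_1^{(k)}` as a point of `T_η`; the block `B^k(y) ⊇ supp f_{y,v}` has sup-diameter `< 1`). [cite: Balaban1982Higgs2, (2.58) p.570 «dist(b, y)», dictionary] -/
theorem dxy_le_sdist1_srcQ (F : OrthFlow ι) (κ : ℝ) (B : ↥(fineDom ((ℓ + 1) ^ i.k) i.Ωc) → ↥(fineDom ((ℓ + 1) ^ i.k) i.Ωc) → ℝ)
    (x : ↥(fineDom ((ℓ + 1) ^ i.k) i.Ωc)) (y : ↥i.Ωc) (v : Sphere ι) :
    supNorm (x.1 - (rbaseEmb (Nat.one_le_pow i.k (ℓ + 1) (Nat.succ_pos ℓ)) i.Ωc y).1) / (((ℓ + 1) ^ i.k : ℕ) : ℝ)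
      ≤ i.sdist1 x (srcQ F κ (Nat.one_le_pow i.k (ℓ + 1) (Nat.succ_pos ℓ)) i.Ωc B y v.1) + 1 := by
  have hn1 : 1 ≤ (ℓ + 1) ^ i.k := Nat.one_le_pow i.k (ℓ + 1) (Nat.succ_pos ℓ)
  have hnr : (0 : ℝ) < (((ℓ + 1) ^ i.k : ℕ) : ℝ) := by exact_mod_cast hn1
  set f := srcQ F κ hn1 i.Ωc B y v.1 with hf
  have key : supNorm (x.1 - (rbaseEmb hn1 i.Ωc y).1) / (((ℓ + 1) ^ i.k : ℕ) : ℝ) - 1 ≤ i.sdist1 x f := by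
    refine lat_le_sdist1 i x f ⟨_, base_mem_supp_srcQ i F κ B y v⟩ fun z hz => ?_
    have hb := blk_eq_of_mem_supp_srcQ i F κ B y v.1 hz
    have h1 : supNorm (z.1 - (rbaseEmb hn1 i.Ωc y).1) ≤ ((ℓ + 1) ^ i.k : ℕ) := supNorm_sub_base_le hn1 hb
    have h2 : supNorm (x.1 - (rbaseEmb hn1 i.Ωc y).1) ≤ supNorm (x.1 - z.1) + supNorm (z.1 - (rbaseEmb hn1 i.Ωc y).1) := by
      rw [← sub_add_sub_cancel x.1 z.1 (rbaseEmb hn1 i.Ωc y).1]; exact supNorm_add_le _ _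
    rw [sub_mul, div_mul_cancel₀ _ hnr.ne', one_mul]
    linarith
  linarith

/-- **`dist(y, Ω^c) ≤ dist(supp f_{y,v}, Ω^c) + 1`** for the corner reading `dist(y, Ω^c) = dist(L^ky, Ω^c)`.
[cite: Balaban1982Higgs2, (2.58) p.571 «dist(y, Ω^c)», dictionary] -/
theorem ydist_le_bdistS_srcQ (F : OrthFlow ι) (κ : ℝ) (B : ↥(fineDom ((ℓ + 1) ^ i.k) i.Ωc) → ↥(fineDom ((ℓ + 1) ^ i.k) i.Ωc) → ℝ)
    (y : ↥i.Ωc) (v : Sphere ι) :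
    i.cdist (rbaseEmb (Nat.one_le_pow i.k (ℓ + 1) (Nat.succ_pos ℓ)) i.Ωc y)
      ≤ i.bdistS (srcQ F κ (Nat.one_le_pow i.k (ℓ + 1) (Nat.succ_pos ℓ)) i.Ωc B y v.1) + 1 := by
  have hn1 : 1 ≤ (ℓ + 1) ^ i.k := Nat.one_le_pow i.k (ℓ + 1) (Nat.succ_pos ℓ)
  have hnr : (0 : ℝ) < (((ℓ + 1) ^ i.k : ℕ) : ℝ) := by exact_mod_cast hn1
  set f := srcQ F κ hn1 i.Ωc B y v.1 with hf
  have key : i.cdist (rbaseEmb hn1 i.Ωc y) - 1 ≤ i.bdistS f := by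
    refine lat_le_bdistS i f ⟨_, base_mem_supp_srcQ i F κ B y v⟩ fun z hz => ?_
    have hb := blk_eq_of_mem_supp_srcQ i F κ B y v.1 hz
    have h1 : supNorm ((rbaseEmb hn1 i.Ωc y).1 - z.1) ≤ ((ℓ + 1) ^ i.k : ℕ) := by
      rw [← B4TorusKernel.supNorm_neg, neg_sub]; exact supNorm_sub_base_le hn1 hb
    have h2 := cdist_le_cdist_add i (rbaseEmb hn1 i.Ωc y) z
    have h3 : supNorm ((rbaseEmb hn1 i.Ωc y).1 - z.1) / (((ℓ + 1) ^ i.k : ℕ) : ℝ) ≤ 1 := by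
      rw [div_le_one hnr]; exact h1
    linarith
  linarith

end Lattice

omit [DecidableEq ι] in
/-- **FROM THE UNIT SPHERE TO ALL OF `ℝ^N`**: a positively homogeneous function bounded by `C` on the unit sphere is bounded
by `C|v|` everywhere. [cite: Balaban1982Higgs2, Prop. 2.2 (2.58) p.570, dictionary] -/
theorem homog_bound_of_sphere {g : (ι → ℝ) → ℝ} (hg : ∀ (c : ℝ) (v : ι → ℝ), 0 ≤ c → g (c • v) = c * g v) {C : ℝ}
    (h : ∀ u : Sphere ι, g u.1 ≤ C) (v : ι → ℝ) : g v ≤ C * siteNorm v := by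
  by_cases hv : siteNorm v = 0
  · have h0 : v = 0 := eq_zero_of_siteNorm_eq_zero hv
    have : g v = 0 := by rw [h0, ← zero_smul ℝ (0 : ι → ℝ), hg 0 0 le_rfl, zero_mul]
    rw [this, hv, mul_zero]
  · have hu : siteNorm ((siteNorm v)⁻¹ • v) = 1 := siteNorm_normalize hv
    have hv' : g v = siteNorm v * g ((siteNorm v)⁻¹ • v) := by
      rw [← hg _ _ (siteNorm_nonneg v), smul_smul, mul_inv_cancel₀ hv, one_smul]
    rw [hv', mul_comm]
    exact mul_le_mul_of_nonneg_right (h ⟨_, hu⟩) (siteNorm_nonneg v)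

omit [DecidableEq ι] in
/-- a homogeneous bound gives a bounded family over the unit sphere. [cite: Balaban1982Higgs2, Prop. 2.2 (2.58) p.570, dictionary] -/
theorem bddAbove_sphere_of_homog {g : (ι → ℝ) → ℝ} {C : ℝ} (h : ∀ v, g v ≤ C * siteNorm v) :
    BddAbove (Set.range fun u : Sphere ι => g u.1) := by
  refine ⟨C, ?_⟩
  rintro _ ⟨u, rfl⟩
  have := h u.1
  rw [u.2, mul_one] at this
  exact this

/-! ## §3. The dictionary instance for r01's family `regionPairFam` (`Ω ⊂ Ω₀ ⊂ ηℤ^{d+1}`); Proposition 2.2; (2.58) -/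

section Family

variable (F : OrthFlow ι) {ℓ : ℕ} {amin aplus m2plus : ℝ}

omit [Fintype ι] [DecidableEq ι] in
/-- `L^k ≥ 1` fine points per unit block side. [cite: Balaban1983RegularityDecay, (1.1) p.572, dictionary] -/
theorem one_le_nK (i : RegionPairInst d ℓ amin aplus m2plus) : 1 ≤ (ℓ + 1) ^ i.k :=
  Nat.one_le_pow i.k (ℓ + 1) (Nat.succ_pos ℓ)

/-- **THE SOURCE `f_{y,v} = Q_k^*(A)(vδ_y)` OF THE MEMBER** (its own field `A`, coupling `eη`, region `Ω`).
[cite: Balaban1982Higgs2, Prop. 2.2 p.570 «Q_k^*(A)»] -/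
def lsrc (i : RegionPairInst d ℓ amin aplus m2plus) (y : ↥i.Ωc) (v : ι → ℝ) :
    ↥(fineDom ((ℓ + 1) ^ i.k) i.Ωc) × ι → ℝ :=
  srcQ F i.κ (one_le_nK i) i.Ωc (acBond i.Ωc i.Ac) y v

/-- the same source read on the larger region `Ω₀` (label `y ∈ Ω^{(k)} ⊂ Ω₀^{(k)}`). [cite: Balaban1982Higgs2, Prop. 2.2 p.571 «δG_k(Ω,Ω₀,A)Q_k^*(A)»] -/
def lsrc₀ (i : RegionPairInst d ℓ amin aplus m2plus) (y : ↥i.Ωc) (v : ι → ℝ) :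
    ↥(fineDom ((ℓ + 1) ^ i.k) i.Ω₀c) × ι → ℝ :=
  srcQ F i.κ (one_le_nK i) i.Ω₀c (acBond i.Ω₀c i.Ac) (B4RegionCubeCarrier.inclY i.hsub y) v

omit [Fintype ι] [DecidableEq ι] in
/-- the base corner `L^ky` of `B^k(y)` — the point `y ∈ T_1^{(k)}` as a point of the fine lattice. [cite: Balaban1982Higgs1, p.605 «T_1^{(k)} ⊂ T_η», dictionary] -/
def lbase (i : RegionPairInst d ℓ amin aplus m2plus) (y : ↥i.Ωc) : ↥(fineDom ((ℓ + 1) ^ i.k) i.Ωc) :=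
  rbaseEmb (one_le_nK i) i.Ωc y

omit [Fintype ι] [DecidableEq ι] in
/-- **`dist(x, y)`** for `x ∈ Ω`, `y ∈ Ω^{(k)}`: `|x − L^ky|_∞` in unit-lattice (`T_η`) units. [cite: Balaban1982Higgs2, (2.58) p.570 «dist(b, y)», dictionary] -/
def ldist (i : RegionPairInst d ℓ amin aplus m2plus) (x : ↥(fineDom ((ℓ + 1) ^ i.k) i.Ωc)) (y : ↥i.Ωc) : ℝ :=
  supNorm (x.1 - (lbase i y).1) / (((ℓ + 1) ^ i.k : ℕ) : ℝ)

/-- **`E(Q_k^{*,Ω}(A)(vδ_y)) = Q_k^{*,Ω₀}(A)(vδ_y)`**: the source extended by zero from `Ω` to `Ω₀` is the source of `Ω₀` at the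
same label (the block `B^k(y) ⊂ Ω` and its contours are the same in both regions). [cite: Balaban1982Higgs2, Prop. 2.2 p.571 «δG_k(Ω,Ω₀,A)Q_k^*(A)», dictionary] -/
theorem extR_lsrc (i : RegionPairInst d ℓ amin aplus m2plus) (y : ↥i.Ωc) (v : ι → ℝ) :
    i.extR (lsrc F i y v) = lsrc₀ F i y v := by
  funext p
  obtain ⟨x0, j⟩ := p
  by_cases hp : B4RegionCubeCarrier.inReg ((ℓ + 1) ^ i.k) i.Ωc x0
  · obtain ⟨x, rfl⟩ := (B4RegionCubeCarrier.inReg_iff (one_le_nK i) i.hsub x0).1 hp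
    rw [i.extR_incl]
    show fld (lsrc F i y v) x j = fld (lsrc₀ F i y v) (B4RegionCubeCarrier.incl (one_le_nK i) i.hsub x) j
    rw [lsrc, lsrc₀, fld_srcQ, fld_srcQ, B4RegionCubeCarrier.contourTrans_incl]
    rfl
  · rw [i.extR_of_not_inReg _ _ hp]
    symm
    refine srcQ_apply_eq_zero_of_blk_ne F i.κ _ i.Ω₀c _ (B4RegionCubeCarrier.inclY i.hsub y) v ?_ j
    intro h
    exact hp (by unfold B4RegionCubeCarrier.inReg; rw [h]; exact y.2)

/-- `δG_k` is homogeneous (the extension/restriction maps are linear). [cite: Balaban1983RegularityDecay, (1.11) p.573, dictionary] -/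
theorem deltaV_smul (i : RegionPairInst d ℓ amin aplus m2plus) (c : ℝ) (f : ↥(fineDom ((ℓ + 1) ^ i.k) i.Ωc) × ι → ℝ) :
    i.deltaV F (c • f) = c • i.deltaV F f := by
  have hE : i.extR (c • f) = c • i.extR f := by
    funext p
    by_cases hp : B4RegionCubeCarrier.inReg ((ℓ + 1) ^ i.k) i.Ωc p.1
    · simp only [RegionPairInst.extR, dif_pos hp, Pi.smul_apply]
    · simp only [RegionPairInst.extR, dif_neg hp, Pi.smul_apply, smul_zero]
  have hR : ∀ g : ↥(fineDom ((ℓ + 1) ^ i.k) i.Ω₀c) × ι → ℝ, i.resR (c • g) = c • i.resR g := fun g => rfl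
  simp only [RegionPairInst.deltaV, hE, Matrix.mulVec_smul, hR, smul_sub]

/-- **THE FOUR KERNEL COLUMNS ARE BOUNDED, HOMOGENEOUSLY IN `v`** — `G_kQ_k^*`. [cite: Balaban1982Higgs2, (2.58) p.570, dictionary] -/
theorem valG_lsrc_le (i : RegionPairInst d ℓ amin aplus m2plus) (x : ↥(fineDom ((ℓ + 1) ^ i.k) i.Ωc)) (y : ↥i.Ωc) :
    ∃ C : ℝ, ∀ v, siteNorm (fld (i.GΩ F *ᵥ lsrc F i y v) x) ≤ C * siteNorm v := by
  refine ⟨Real.sqrt (Fintype.card ι) * ∑ j, ∑ q, |(i.GΩ F * (avgQ F i.κ (one_le_nK i) i.Ωc (acBond i.Ωc i.Ac))ᵀ) (x, j) q|,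
    fun v => ?_⟩
  rw [lsrc, ← fld_mul_avgQ_transpose_mulVec_single, mul_assoc]
  exact siteNorm_fld_mulVec_single_le _ x y v

/-- — `D^η_{A,μ}G_kQ_k^*`. [cite: Balaban1982Higgs2, (2.58) p.570, dictionary] -/
theorem valDG_lsrc_le (i : RegionPairInst d ℓ amin aplus m2plus) (μ : Fin (d + 1)) (x : ↥(fineDom ((ℓ + 1) ^ i.k) i.Ωc))
    (y : ↥i.Ωc) : ∃ C : ℝ, ∀ v, siteNorm (fld (i.DΩ F μ *ᵥ (i.GΩ F *ᵥ lsrc F i y v)) x) ≤ C * siteNorm v := by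
  refine ⟨Real.sqrt (Fintype.card ι) *
      ∑ j, ∑ q, |(i.DΩ F μ * i.GΩ F * (avgQ F i.κ (one_le_nK i) i.Ωc (acBond i.Ωc i.Ac))ᵀ) (x, j) q|, fun v => ?_⟩
  rw [Matrix.mulVec_mulVec, lsrc, ← fld_mul_avgQ_transpose_mulVec_single, mul_assoc]
  exact siteNorm_fld_mulVec_single_le _ x y v

/-- — `δG_kQ_k^*`. [cite: Balaban1982Higgs2, (2.58) p.571, dictionary] -/
theorem dvalG_lsrc_le (i : RegionPairInst d ℓ amin aplus m2plus) (x : ↥(fineDom ((ℓ + 1) ^ i.k) i.Ωc)) (y : ↥i.Ωc) :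
    ∃ C : ℝ, ∀ v, siteNorm (fld (i.deltaV F (lsrc F i y v)) x) ≤ C * siteNorm v := by
  obtain ⟨C₁, h₁⟩ := valG_lsrc_le F i x y
  refine ⟨C₁ + Real.sqrt (Fintype.card ι) *
      ∑ j, ∑ q, |(i.G₀ F * (avgQ F i.κ (one_le_nK i) i.Ω₀c (acBond i.Ω₀c i.Ac))ᵀ)
        (B4RegionCubeCarrier.incl (one_le_nK i) i.hsub x, j) q|, fun v => ?_⟩
  have hsplit : fld (i.deltaV F (lsrc F i y v)) x
      = fld (i.GΩ F *ᵥ lsrc F i y v) x - fld (i.G₀ F *ᵥ lsrc₀ F i y v) (B4RegionCubeCarrier.incl (one_le_nK i) i.hsub x) := by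
    rw [RegionPairInst.deltaV, extR_lsrc]; rfl
  rw [hsplit, add_mul]
  refine (B4Lemma22HolderBox.siteNorm_sub_le _ _).trans (add_le_add (h₁ v) ?_)
  rw [lsrc₀, ← fld_mul_avgQ_transpose_mulVec_single, mul_assoc]
  exact siteNorm_fld_mulVec_single_le _ _ _ v

/-- — `D^η_{A,μ}δG_kQ_k^*` on a bond `⟨x, x + ηe_μ⟩ ⊂ Ω`. [cite: Balaban1982Higgs2, (2.58) p.571, dictionary] -/
theorem dvalDG_lsrc_le (i : RegionPairInst d ℓ amin aplus m2plus) (μ : Fin (d + 1)) (x : ↥(fineDom ((ℓ + 1) ^ i.k) i.Ωc))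
    (hx : x.1 + e1 μ ∈ fineDom ((ℓ + 1) ^ i.k) i.Ωc) (y : ↥i.Ωc) :
    ∃ C : ℝ, ∀ v, siteNorm (fld (i.DΩ F μ *ᵥ i.deltaV F (lsrc F i y v)) x) ≤ C * siteNorm v := by
  obtain ⟨C₁, h₁⟩ := valDG_lsrc_le F i μ x y
  refine ⟨C₁ + Real.sqrt (Fintype.card ι) *
      ∑ j, ∑ q, |(i.D₀ F μ * i.G₀ F * (avgQ F i.κ (one_le_nK i) i.Ω₀c (acBond i.Ω₀c i.Ac))ᵀ)
        (B4RegionCubeCarrier.incl (one_le_nK i) i.hsub x, j) q|, fun v => ?_⟩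
  have hsplit : fld (i.DΩ F μ *ᵥ i.deltaV F (lsrc F i y v)) x
      = fld (i.DΩ F μ *ᵥ (i.GΩ F *ᵥ lsrc F i y v)) x
        - fld (i.D₀ F μ *ᵥ (i.G₀ F *ᵥ lsrc₀ F i y v)) (B4RegionCubeCarrier.incl (one_le_nK i) i.hsub x) := by
    rw [RegionPairInst.deltaV, Matrix.mulVec_sub, extR_lsrc]
    funext j
    show (i.DΩ F μ *ᵥ (i.GΩ F *ᵥ lsrc F i y v) - i.DΩ F μ *ᵥ i.resR (i.G₀ F *ᵥ lsrc₀ F i y v)) (x, j) = _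
    rw [Pi.sub_apply, i.DΩ_resR_apply F μ _ x hx j]
    rfl
  rw [hsplit, add_mul]
  refine (B4Lemma22HolderBox.siteNorm_sub_le _ _).trans (add_le_add (h₁ v) ?_)
  rw [Matrix.mulVec_mulVec, lsrc₀, ← fld_mul_avgQ_transpose_mulVec_single, mul_assoc]
  exact siteNorm_fld_mulVec_single_le _ _ _ v

variable [Nonempty ι] (creg β : ℝ) (K : ℕ)

/-- **THE DICTIONARY INSTANCE OF `B2Prop22Proof` AT A MEMBER OF r01's FAMILY** (allowance `D = 1`): the Prop.-I.2.1
instance is `regionPairFam … i`; the points `y ∈ Ω^{(k)}` are the unit labels of `Ω`; the bonds `b = ⟨b₋, b₋ + ηe_μ⟩ ⊂ Ω`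
are read at `b₋`; the test vectors range over the unit sphere of `ℝ^N` (so the kernels of the linked `P22Setting` are
the operator norms of the `N × N` blocks, `|(TQ_k^*(A))(x,y)| = sup_{|v|=1}|(Tf_{y,v})(x)|`); `f_{y,v} = Q_k^*(A)(vδ_y)`;
`dist(x, y) = |x − L^ky|_∞`, `dist(b, y) = dist(b₋, y)`, `dist(b, Ω^c) = dist(b₋, Ω^c)`, `dist(y, Ω^c) = dist(L^ky, Ω^c)`
(the point `y` of `T_1^{(k)}` as a point of the fine lattice, I p. 605). [cite: Balaban1982Higgs2, Prop. 2.2 (2.58) pp.570–571] -/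
def latDict (i : RegionPairInst d ℓ amin aplus m2plus) : Dict 1 where
  S := regionPairFam F d ℓ amin aplus m2plus creg β K i
  KSite := ↥i.Ωc
  Bond := {b : ↥(fineDom ((ℓ + 1) ^ i.k) i.Ωc) × Fin (d + 1) // b.1.1 + e1 b.2 ∈ fineDom ((ℓ + 1) ^ i.k) i.Ωc}
  base := fun b => b.1.1
  dir := fun b => b.1.2
  hDir := ⟨(0 : Fin (d + 1))⟩
  V := Sphere ι
  hV := sphere_nonempty
  src := fun y v => lsrc F i y v.1
  dxy := fun x y => ldist i x y
  dby := fun b y => ldist i b.1.1 y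
  bdistB := fun b => i.cdist b.1.1
  ydist := fun y => i.cdist (lbase i y)
  supNorm_src := fun y v =>
    (supN_srcQ_le F i.κ (one_le_nK i) i.Ωc (acBond i.Ωc i.Ac) y v.1).trans (le_of_eq v.2)
  dxy_le := fun x y v => dxy_le_sdist1_srcQ i F i.κ (acBond i.Ωc i.Ac) x y v
  ydist_le := fun y v => ydist_le_bdistS_srcQ i F i.κ (acBond i.Ωc i.Ac) y v
  dby_le := fun _ _ => le_rfl
  bdistB_le := fun _ => le_rfl

/-- the linked `P22Setting`'s kernel `|(G_kQ_k^*)(x,y)|` IS `sup_{|v|=1} |(G_k(Ω,A)f_{y,v})(x)|` for the member's Green's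
function (definitional unfolding, for the record). [cite: Balaban1982Higgs2, (2.58) p.570] -/
theorem kGQ_latDict (i : RegionPairInst d ℓ amin aplus m2plus) (x : ↥(fineDom ((ℓ + 1) ^ i.k) i.Ωc)) (y : ↥i.Ωc) :
    (latDict F creg β K i).toP22.kGQ x y = ⨆ u : Sphere ι, siteNorm (fld (i.GΩ F *ᵥ lsrc F i y u.1) x) := rfl

end Family

/-! ## §4. PROPOSITION 2.2 AT A REGULAR FIELD on the family; (2.58) in explicit form -/

section Main

variable [Nonempty ι] (F : OrthFlow ι)

/-- **PROPOSITION 2.2 (2.58) HOLDS AT EVERY (I.2.23)/(1.7)-REGULAR VECTOR FIELD ON THE FAMILY OF GENERAL PAIRS `Ω ⊂ Ω₀` OF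
FINITE UNIONS OF BIG BLOCKS OF `ηℤ^{d+1}`** — r14's typed `B2StepK.Prop22Printed` for the linked family of `P22Setting`s: for
every orthogonal one-parameter flow (1.2) with `|(U(t) − 1)v|² ≤ (ℓ₁t)²|v|²`, `L = ℓ+1 ≥ 2`, `a₋ > 0`, `c ≥ 0`, `β > 0`
there are `δ₀, c₀, R₀, e₁ > 0` such that for EVERY member (scale `k ≥ 1`, pair `Ω ⊂ Ω₀` of unions of `Kmod`-blocks, field
`A` (1.7)-regular on `Ω₀`, coupling `0 < e ≤ e₁`) the four kernels of (2.58) obey the printed bounds at `dist(b, Ω^c) ≥ R₀`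
resp. `dist(x, Ω^c) ≥ R₀` — «This proposition is a simple corollary of Proposition I.2.1» (p17's `prop22Printed_of_B4clause`,
α = 0 clause of r01's `thmPrintedNN_regionPairFam`). [cite: Balaban1982Higgs2, Prop. 2.2 (2.58) pp.570–571] -/
theorem prop22Printed_regionPairFam {ℓ₁ : ℝ} (hℓ₁ : 0 ≤ ℓ₁)
    (hLip : ∀ t (v : ι → ℝ), ((F.U t - 1) *ᵥ v) ⬝ᵥ ((F.U t - 1) *ᵥ v) ≤ (ℓ₁ * t) ^ 2 * (v ⬝ᵥ v))
    (d ℓ : ℕ) (hℓ : 1 ≤ ℓ) (amin aplus m2plus : ℝ) (ha : 0 < amin) (creg β : ℝ) (hcreg : 0 ≤ creg) (hβ : 0 < β) :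
    B2StepK.Prop22Printed (fun i : RegionPairInst d ℓ amin aplus m2plus =>
      (latDict F creg β (Kmod F hℓ₁ hLip d ℓ hℓ amin aplus m2plus ha) i).toP22) :=
  prop22Printed_of_B4clause zero_le_one _ 0
    (thmPrintedNN_regionPairFam F hℓ₁ hLip d ℓ hℓ amin aplus m2plus ha creg β hcreg hβ 0 le_rfl zero_lt_one)

/-- **The statement for the PRINTED link variables (1.2) `U(A) = e^{qeηA}`**, every antisymmetric `N × N` matrix `q`.
[cite: Balaban1982Higgs2, Prop. 2.2 (2.58) pp.570–571; Balaban1983RegularityDecay, (1.2) p.572] -/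
theorem prop22Printed_regionPairFam_exp (q : Matrix ι ι ℝ) (hq : qᵀ = -q)
    (d ℓ : ℕ) (hℓ : 1 ≤ ℓ) (amin aplus m2plus : ℝ) (ha : 0 < amin) (creg β : ℝ) (hcreg : 0 ≤ creg) (hβ : 0 < β) :
    B2StepK.Prop22Printed (fun i : RegionPairInst d ℓ amin aplus m2plus =>
      (latDict (expFlow q hq) creg β
        (Kmod (expFlow q hq) (Real.sqrt_nonneg _) (expFlow_lipschitz q hq) d ℓ hℓ amin aplus m2plus ha) i).toP22) :=
  prop22Printed_regionPairFam (expFlow q hq) (Real.sqrt_nonneg _) (expFlow_lipschitz q hq) d ℓ hℓ amin aplus m2plus ha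
    creg β hcreg hβ

/-- **Non-vacuity for the record**: below every threshold the family has members meeting all antecedents (r01's
`hypotheses_met`). [cite: Balaban1982Higgs2, Prop. 2.2 p.570] -/
theorem regionPairFam_nonvacuous {ℓ₁ : ℝ} (hℓ₁ : 0 ≤ ℓ₁)
    (hLip : ∀ t (v : ι → ℝ), ((F.U t - 1) *ᵥ v) ⬝ᵥ ((F.U t - 1) *ᵥ v) ≤ (ℓ₁ * t) ^ 2 * (v ⬝ᵥ v))
    (d ℓ : ℕ) (hℓ : 1 ≤ ℓ) {amin aplus m2plus : ℝ} (ha : 0 < amin) (hap : amin ≤ aplus) (hm : 0 ≤ m2plus)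
    (creg β : ℝ) (hcreg : 0 ≤ creg) (e₁ : ℝ) (he₁ : 0 < e₁) :
    ∃ i : RegionPairInst d ℓ amin aplus m2plus,
      (latDict F creg β (Kmod F hℓ₁ hLip d ℓ hℓ amin aplus m2plus ha) i).toP22.regular ∧
      (latDict F creg β (Kmod F hℓ₁ hLip d ℓ hℓ amin aplus m2plus ha) i).toP22.bigBlocks ∧
      0 < (latDict F creg β (Kmod F hℓ₁ hLip d ℓ hℓ amin aplus m2plus ha) i).toP22.e ∧
      (latDict F creg β (Kmod F hℓ₁ hLip d ℓ hℓ amin aplus m2plus ha) i).toP22.e ≤ e₁ := by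
  have hK : 1 ≤ Kmod F hℓ₁ hLip d ℓ hℓ amin aplus m2plus ha :=
    le_trans (by norm_num) (Classical.choose_spec (B4ThmRegionPairEta.region_pair_members F hℓ₁ hLip d ℓ hℓ amin aplus m2plus ha)).1
  exact hypotheses_met F d ℓ hap hm creg β hcreg _ hK e₁ he₁

/-- **(2.58) EXPLICITLY, ALL FOUR CLAUSES, AT EVERY REGULAR FIELD** (unit-lattice units; `dist(x,y) = |x − L^ky|_∞`):
there are `δ₀, c₀, R₀, e₁ > 0` such that for every member as above, every `x ∈ Ω` with `dist(x, Ω^c) ≥ R₀`, every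
`y ∈ Ω^{(k)}` and every `v ∈ ℝ^N`:
`|(G_k(Ω,A)Q_k^*(A))(x,y)v| ≤ c₀e^{−δ₀dist(x,y)}|v|`; for every bond `⟨x, x+ηe_μ⟩ ⊂ Ω`:
`|(D^η_{A,μ}G_k(Ω,A)Q_k^*(A))(x,y)v| ≤ c₀e^{−δ₀dist(x,y)}|v|`; and the two `δG_k(Ω,Ω₀,A) = G_k(Ω,A) − G_k(Ω₀,A)` versions
with the additional factor `exp(−δ₀(dist(x,Ω^c) + dist(y,Ω^c)))`. [cite: Balaban1982Higgs2, Prop. 2.2 (2.58) pp.570–571] -/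
theorem ineq258_regionPairFam {ℓ₁ : ℝ} (hℓ₁ : 0 ≤ ℓ₁)
    (hLip : ∀ t (v : ι → ℝ), ((F.U t - 1) *ᵥ v) ⬝ᵥ ((F.U t - 1) *ᵥ v) ≤ (ℓ₁ * t) ^ 2 * (v ⬝ᵥ v))
    (d ℓ : ℕ) (hℓ : 1 ≤ ℓ) (amin aplus m2plus : ℝ) (ha : 0 < amin) (creg β : ℝ) (hcreg : 0 ≤ creg) (hβ : 0 < β) :
    ∃ δ₀ c₀ R₀ e₁ : ℝ, 0 < δ₀ ∧ 0 < c₀ ∧ 0 < R₀ ∧ 0 < e₁ ∧ ∀ i : RegionPairInst d ℓ amin aplus m2plus,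
      (regionPairFam F d ℓ amin aplus m2plus creg β (Kmod F hℓ₁ hLip d ℓ hℓ amin aplus m2plus ha) i).regular →
      (regionPairFam F d ℓ amin aplus m2plus creg β (Kmod F hℓ₁ hLip d ℓ hℓ amin aplus m2plus ha) i).bigBlocks →
      0 < i.e → i.e ≤ e₁ →
      ∀ (x : ↥(fineDom ((ℓ + 1) ^ i.k) i.Ωc)) (y : ↥i.Ωc) (v : ι → ℝ), R₀ ≤ i.cdist x →
        siteNorm (fld (i.GΩ F *ᵥ lsrc F i y v) x) ≤ c₀ * Real.exp (-(δ₀ * ldist i x y)) * siteNorm v ∧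
        (∀ μ : Fin (d + 1), x.1 + e1 μ ∈ fineDom ((ℓ + 1) ^ i.k) i.Ωc →
          siteNorm (fld (i.DΩ F μ *ᵥ (i.GΩ F *ᵥ lsrc F i y v)) x) ≤ c₀ * Real.exp (-(δ₀ * ldist i x y)) * siteNorm v) ∧
        siteNorm (fld (i.deltaV F (lsrc F i y v)) x)
          ≤ c₀ * Real.exp (-(δ₀ * ldist i x y)) * Real.exp (-(δ₀ * (i.cdist x + i.cdist (lbase i y)))) * siteNorm v ∧
        (∀ μ : Fin (d + 1), x.1 + e1 μ ∈ fineDom ((ℓ + 1) ^ i.k) i.Ωc →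
          siteNorm (fld (i.DΩ F μ *ᵥ i.deltaV F (lsrc F i y v)) x)
            ≤ c₀ * Real.exp (-(δ₀ * ldist i x y)) * Real.exp (-(δ₀ * (i.cdist x + i.cdist (lbase i y)))) * siteNorm v) := by
  obtain ⟨δ₀, c₀, R₀, e₁, hδ, hc, hR, he, H⟩ :=
    prop22Printed_regionPairFam F hℓ₁ hLip d ℓ hℓ amin aplus m2plus ha creg β hcreg hβ
  refine ⟨δ₀, c₀, R₀, e₁, hδ, hc, hR, he, fun i hreg hbig he0 he1 x y v hx => ?_⟩
  obtain ⟨h1, h2, h3, h4⟩ := H i hreg hbig he0 he1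
  have hsm : ∀ (c : ℝ) (w : ι → ℝ), lsrc F i y (c • w) = c • lsrc F i y w :=
    fun c w => srcQ_smul F i.κ (one_le_nK i) i.Ωc (acBond i.Ωc i.Ac) y c w
  refine ⟨?_, fun μ hμ => ?_, ?_, fun μ hμ => ?_⟩
  · refine homog_bound_of_sphere (g := fun w => siteNorm (fld (i.GΩ F *ᵥ lsrc F i y w) x)) (fun c w hc0 => ?_) (fun u => ?_) v
    · simp only [hsm, Matrix.mulVec_smul]
      rw [show fld (c • (i.GΩ F *ᵥ lsrc F i y w)) x = c • fld (i.GΩ F *ᵥ lsrc F i y w) x from rfl, siteNorm_smul,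
        abs_of_nonneg hc0]
    · obtain ⟨C, hC⟩ := valG_lsrc_le F i x y
      exact (le_ciSup (bddAbove_sphere_of_homog hC) u).trans (h2 x y hx)
  · refine homog_bound_of_sphere (g := fun w => siteNorm (fld (i.DΩ F μ *ᵥ (i.GΩ F *ᵥ lsrc F i y w)) x))
      (fun c w hc0 => ?_) (fun u => ?_) v
    · simp only [hsm, Matrix.mulVec_smul]
      rw [show fld (c • (i.DΩ F μ *ᵥ (i.GΩ F *ᵥ lsrc F i y w))) x = c • fld (i.DΩ F μ *ᵥ (i.GΩ F *ᵥ lsrc F i y w)) x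
        from rfl, siteNorm_smul, abs_of_nonneg hc0]
    · obtain ⟨C, hC⟩ := valDG_lsrc_le F i μ x y
      exact (le_ciSup (bddAbove_sphere_of_homog hC) u).trans
        (h1 ⟨(x, μ), hμ⟩ y hx)
  · refine homog_bound_of_sphere (g := fun w => siteNorm (fld (i.deltaV F (lsrc F i y w)) x)) (fun c w hc0 => ?_)
      (fun u => ?_) v
    · simp only [hsm, deltaV_smul]
      rw [show fld (c • i.deltaV F (lsrc F i y w)) x = c • fld (i.deltaV F (lsrc F i y w)) x from rfl, siteNorm_smul,
        abs_of_nonneg hc0]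
    · obtain ⟨C, hC⟩ := dvalG_lsrc_le F i x y
      exact (le_ciSup (bddAbove_sphere_of_homog hC) u).trans (h4 x y hx)
  · refine homog_bound_of_sphere (g := fun w => siteNorm (fld (i.DΩ F μ *ᵥ i.deltaV F (lsrc F i y w)) x))
      (fun c w hc0 => ?_) (fun u => ?_) v
    · simp only [hsm, deltaV_smul, Matrix.mulVec_smul]
      rw [show fld (c • (i.DΩ F μ *ᵥ i.deltaV F (lsrc F i y w))) x = c • fld (i.DΩ F μ *ᵥ i.deltaV F (lsrc F i y w)) x
        from rfl, siteNorm_smul, abs_of_nonneg hc0]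
    · obtain ⟨C, hC⟩ := dvalDG_lsrc_le F i μ x hμ y
      exact (le_ciSup (bddAbove_sphere_of_homog hC) u).trans (h3 ⟨(x, μ), hμ⟩ y hx)

end Main

end

end Literature.MathematicalPhysics.QuantumFieldTheory.Balaban1983to89.B2Prop22RegularRegionPair
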